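import Summits.BirchSwinnertonDyer.BirchSwinnertonDyer.Theorems.GoldfeldAllTwistsTwoConverseTwinGenusDescent
import HarnessLib

set_option linter.dupNamespace false -- `…BirchSwinnertonDyer.BirchSwinnertonDyer…` is the cell's namespace (D-0017)
set_option autoImplicit false

/-!
# LINE B49 — the FIXED partner curves of the genus mechanism, II: `49a1^{(−2)}` (`N = 3136`) has
# rank EXACTLY `1`, `Ш[2] = 0`, and `(4, 8)` is an ODD multiple of a generator (family F2, `d_K = −8q`)

Cell `bsd-goldfeld`, seat `bsd-goldfeld-s1p-c301` (prover, gen 6); TARGET v5.2 §2 c301 (f), planner g14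
ruling (xvi). Support for item `stmt-BirchSwinnertonDyer-19140` (twin″; joint with 20044 K12₂″) of
`route-BirchSwinnertonDyer-GoldfeldAllTwistsTwoConverse`. HONEST FRAMING: theorems about one explicit
elliptic curve over `ℚ`; BSD is not proved by any of this; both cruxes stay OPEN. Not in the Theses cone.

The companion of `…TwinGenusDescent.lean` (family F1, `49a1^{(−1)}`) for the second inert prime-twist
family `49a1^{(−2q)}`, `q ≡ 1 (mod 4)`, `(q/7) = −1` (`d_K = −8q`, genus field `ℚ(√−2, √q)`, seat
c301 gen 4's `X049BirchLemmaEvenDiscrEight`): the genus character `χ ↔ (−8)(q)` twists the Heegner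
point into `X₀(49)(ℚ(√−2))⁻ ≅ 49a1^{(−2)}(ℚ)` — the FIXED rank-one curve `[0,0,0,−140,784]` of
conductor `3136` (memo `B49-GENUS.md` §1, F2) — and the named point is `g' = (−2, 1 + 2√−2) ∈ X₀(49)(ℚ(√−2))`,
whose image under the twist substitution `(X, Y) = (t²x, t³(y + x/2))`, `t = √−2`, is
`g₃₁₃₆ = (4, 8) ∈ cm7^{(−2)}(ℚ)`, `cm7^{(−2)} = [0, 3/2, 0, −8, 8]`. Same method as file I: seat c301
gen 2's descent `rank_le_one_and_sha_two_inertTwoTwist` (`S(−42m,448m²) ⊆ {1,2,7,14}`,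
`S(84m,−28m²) ⊆ {1,−7}`) at `m = 1` for the upper bound; on the two-torsion model
`y² = x³ − 42x² + 448x = (1/2, −4, 0, 0) • cm7^{(−2)}` the point is `(32, 64)`, `α = [32] = [2]`,
`[b] = [448] = [7]`, `a² − 4b = −28 ~ −7`, so `(4, 8) ∉ 2E(F) + tors` over every field `F ⊇ ℚ` with
`−7, 7, 2, 14 ∉ F²` (seat c3 gen 6's odd-multiple descent lemma), whence infinite order, `rank ≥ 1`,
odd index and odd coordinate along any Mordell–Weil basis (§0 of file I).

CONTENTS: `isElliptic_cm7_quadraticTwist_neg_two`, `nonsingular_…_four_eight`,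
`twoTorsionChange_smul_cm7_quadraticTwist_neg_two` (any `F`), `fourEight_ne_two_zsmul_add_of_twoTorsionChange`
/ `…_cm7_quadraticTwist_neg_two` / `not_isOfFinAddOrder_fourEight_…`; over `ℚ`: `…_rat` versions,
`rank_le_one_and_sha_two_…`, **`mordellWeilRank_cm7_quadraticTwist_neg_two` (`= 1`)**,
**`forall_mem_sha_two_cm7_quadraticTwist_neg_two`**, `exists_odd_zsmul_sub_zsmul_fourEight_…`,
`exists_odd_fourEight_sub_zsmul_basis_…`.

References: J. H. Silverman, J. T. Tate, *Rational Points on Elliptic Curves* (2015) §3.5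
[SilvermanTate2015]; J. H. Silverman, *AEC* (2009) III.1, VIII.6.7, X.4.2, X.4.9 [SilvermanAEC2009];
J. E. Cremona, *Algorithms for Modular Elliptic Curves* (1997) Table 1 (curve 3136) [CremonaAlgorithms1997];
B. Gross, *Heegner points on X₀(N)* (1984) §§4–5 [Gross1984].
-/

noncomputable section

open scoped Classical

open WeierstrassCurve Literature.NumberTheory.EllipticCurves

namespace Summit.BirchSwinnertonDyer.BirchSwinnertonDyer.Theorems.GoldfeldGoodTwists

/-! ## §2 `49a1^{(−2)}` (`N = 3136`): two-torsion model, the point `(4, 8)`, rank `1`, `Ш[2] = 0` -/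

section NegTwo

/-- `cm7^{(−2)} = [0, 3/2, 0, −8, 8]` is elliptic. [folklore] -/
theorem isElliptic_cm7_quadraticTwist_neg_two : (cm7.quadraticTwist (-2)).IsElliptic :=
  cm7.isElliptic_quadraticTwist (by norm_num)

/-- The point `(4, 8)` lies on `cm7^{(−2)} : y² = x³ + (3/2)x² − 8x + 8` (the image of
`(−2, 1 + 2√−2) ∈ X₀(49)(ℚ(√−2))` under the twist substitution; on the reduced minimal model
`[0,0,0,−140,784]` it is `(18, 64)`). [folklore] -/
theorem nonsingular_cm7_quadraticTwist_neg_two_four_eight :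
    (cm7.quadraticTwist (-2)).toAffine.Nonsingular 4 8 := by
  haveI := isElliptic_cm7_quadraticTwist_neg_two
  refine (Affine.equation_iff_nonsingular).mp ?_
  rw [Affine.equation_iff']
  simp [quadraticTwist, b₂, b₄, b₆]
  norm_num

/-- Over any field `F` of characteristic `0`: `(u, r, s, t) = (1/2, −4, 0, 0)` takes `cm7^{(−2)} ⊗ F`
to the two-torsion normal form `y² = x³ − 42x² + 448x`. [cite: SilvermanAEC2009, III.1 Table 3.1] -/
theorem twoTorsionChange_smul_cm7_quadraticTwist_neg_two (F : Type*) [Field F] [CharZero F] :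
    (⟨(Units.mk0 (2 : F) two_ne_zero)⁻¹, -4, 0, 0⟩ : VariableChange F) •
        (cm7.quadraticTwist (-2)).baseChange F = ⟨0, -42, 0, 448, 0⟩ := by
  ext <;> simp [baseChange, quadraticTwist, b₂, b₄, b₆, variableChange_a₁, variableChange_a₂,
    variableChange_a₃, variableChange_a₄, variableChange_a₆] <;> norm_num

variable {F : Type*} [Field F] [CharZero F]

/-- **The point `(4, 8)` of `cm7^{(−2)}` is not in `2E(F) + E(F)_tors`** over any field `F` of
characteristic `0` in which `−7, 7, 2, 14` are not squares, for any model `E/F` carried by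
`(1/2, −4, 0, 0)` to `y² = x³ − 42x² + 448x` (there the point is `(32, 64)`: `α = [32] = [2]`,
`[b] = [448] = [7]`, `a² − 4b = −28 ~ −7`). [cite: SilvermanTate2015, §3.5] -/
theorem fourEight_ne_two_zsmul_add_of_twoTorsionChange {E : WeierstrassCurve F} [E.IsElliptic]
    (hE : (⟨(Units.mk0 (2 : F) two_ne_zero)⁻¹, -4, 0, 0⟩ : VariableChange F) • E = ⟨0, -42, 0, 448, 0⟩)
    (h7 : ¬ IsSquare (-7 : F)) (h7' : ¬ IsSquare (7 : F)) (h2 : ¬ IsSquare (2 : F))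
    (h14 : ¬ IsSquare (14 : F)) (h48 : E.toAffine.Nonsingular 4 8)
    (R t : E.toAffine.Point) (ht : IsOfFinAddOrder t) : Affine.Point.some 4 8 h48 ≠ (2 : ℤ) • R + t := by
  let C : VariableChange F := ⟨(Units.mk0 (2 : F) two_ne_zero)⁻¹, -4, 0, 0⟩
  have hVeq : C • E = ⟨0, -42, 0, 448, 0⟩ := hE
  haveI : (C • E).IsTwoTorsionNF := by rw [hVeq]; infer_instance
  have ha₂ : (C • E).a₂ = -42 := by rw [hVeq]
  have ha₄ : (C • E).a₄ = 448 := by rw [hVeq]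
  have hD : ¬ IsSquare ((C • E).a₂ ^ 2 - 4 * (C • E).a₄) := by
    rw [ha₂, ha₄]; rintro ⟨r, hr⟩
    exact h7 (isSquare_of_sq_mul (k := 2) (by norm_num) (by linear_combination hr.symm))
  have hb : ¬ IsSquare (C • E).a₄ := by
    rw [ha₄]; rintro ⟨r, hr⟩
    exact h7' (isSquare_of_sq_mul (k := 8) (by norm_num) (by linear_combination hr.symm))
  have hx : C.toX 4 = 32 := by
    rw [VariableChange.toX_def]; simp only [C, inv_inv, Units.val_mk0]; norm_num
  have h48' := (VariableChange.nonsingular_iff _ C 4 8).mpr h48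
  have hsq1 : ¬ IsSquare (C.toX 4) := by
    rw [hx]; rintro ⟨r, hr⟩
    exact h2 (isSquare_of_sq_mul (k := 4) (by norm_num) (by linear_combination hr.symm))
  have hsq2 : ¬ IsSquare (C.toX 4 * (C • E).a₄) := by
    rw [hx, ha₄]; rintro ⟨r, hr⟩
    exact h14 (isSquare_of_sq_mul (k := 32) (by norm_num) (by linear_combination hr.symm))
  refine ne_two_zsmul_add_of_addEquiv (VariableChange.pointEquiv _ C) (fun R' t' ht' => ?_) R t ht
  rw [VariableChange.pointEquiv_some]
  exact some_ne_two_zsmul_add_of_not_isSquare _ hD hb h48' (by rw [hx]; norm_num) hsq1 hsq2 R' t' ht'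

/-- **`(4, 8) ∈ cm7^{(−2)}(F)` is not in `2·cm7^{(−2)}(F) + tors`**, `F ⊇ ℚ` any field in which
`−7, 7, 2, 14` are not squares. [cite: SilvermanTate2015, §3.5] -/
theorem fourEight_ne_two_zsmul_add_cm7_quadraticTwist_neg_two (h7 : ¬ IsSquare (-7 : F))
    (h7' : ¬ IsSquare (7 : F)) (h2 : ¬ IsSquare (2 : F)) (h14 : ¬ IsSquare (14 : F))
    (h48 : ((cm7.quadraticTwist (-2)).baseChange F).toAffine.Nonsingular 4 8)
    (R t : ((cm7.quadraticTwist (-2)).baseChange F).toAffine.Point) (ht : IsOfFinAddOrder t) :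
    Affine.Point.some 4 8 h48 ≠ (2 : ℤ) • R + t :=
  haveI := isElliptic_cm7_quadraticTwist_neg_two
  fourEight_ne_two_zsmul_add_of_twoTorsionChange (twoTorsionChange_smul_cm7_quadraticTwist_neg_two F)
    h7 h7' h2 h14 h48 R t ht

/-- **… hence `(4, 8) ∈ cm7^{(−2)}(F)` has infinite order** (same fields).
[cite: SilvermanTate2015, §3.5] -/
theorem not_isOfFinAddOrder_fourEight_cm7_quadraticTwist_neg_two (h7 : ¬ IsSquare (-7 : F))
    (h7' : ¬ IsSquare (7 : F)) (h2 : ¬ IsSquare (2 : F)) (h14 : ¬ IsSquare (14 : F))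
    (h48 : ((cm7.quadraticTwist (-2)).baseChange F).toAffine.Nonsingular 4 8) :
    ¬ IsOfFinAddOrder (Affine.Point.some 4 8 h48) := fun hfin =>
  fourEight_ne_two_zsmul_add_cm7_quadraticTwist_neg_two h7 h7' h2 h14 h48 0 _ hfin
    (by rw [smul_zero, zero_add])

/-! ### Over `ℚ`: rank exactly `1`, `Ш[2] = 0`, odd index -/

/-- The two-torsion change over `ℚ`: `(1/2, −4, 0, 0) • cm7^{(−2)} = [0, −42, 0, 448, 0]`.
[cite: SilvermanAEC2009, III.1 Table 3.1] -/
theorem twoTorsionChange_smul_cm7_quadraticTwist_neg_two_rat :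
    (⟨(Units.mk0 (2 : ℚ) two_ne_zero)⁻¹, -4, 0, 0⟩ : VariableChange ℚ) • cm7.quadraticTwist (-2) =
      ⟨0, -42, 0, 448, 0⟩ := by
  ext <;> simp [quadraticTwist, b₂, b₄, b₆, variableChange_a₁, variableChange_a₂,
    variableChange_a₃, variableChange_a₄, variableChange_a₆] <;> norm_num

/-- **`g₃₁₃₆ := (4, 8) ∈ cm7^{(−2)}(ℚ)` is not in `2·cm7^{(−2)}(ℚ) + tors`.**
[cite: SilvermanTate2015, §3.5] -/
theorem fourEight_ne_two_zsmul_add_cm7_quadraticTwist_neg_two_rat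
    (R t : (cm7.quadraticTwist (-2)).toAffine.Point) (ht : IsOfFinAddOrder t) :
    Affine.Point.some 4 8 nonsingular_cm7_quadraticTwist_neg_two_four_eight ≠ (2 : ℤ) • R + t := by
  haveI := isElliptic_cm7_quadraticTwist_neg_two
  have h := fourEight_ne_two_zsmul_add_of_twoTorsionChange
    twoTorsionChange_smul_cm7_quadraticTwist_neg_two_rat not_isSquare_rat_neg7_7_2_14.1
    not_isSquare_rat_neg7_7_2_14.2.1 not_isSquare_rat_neg7_7_2_14.2.2.1
    not_isSquare_rat_neg7_7_2_14.2.2.2 nonsingular_cm7_quadraticTwist_neg_two_four_eight R t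
    (by convert ht)
  convert h

/-- **`(4, 8) ∈ cm7^{(−2)}(ℚ)` has infinite order.** [cite: SilvermanTate2015, §3.5] -/
theorem not_isOfFinAddOrder_fourEight_cm7_quadraticTwist_neg_two_rat :
    ¬ IsOfFinAddOrder (Affine.Point.some 4 8 nonsingular_cm7_quadraticTwist_neg_two_four_eight :
      (cm7.quadraticTwist (-2)).toAffine.Point) := by
  intro hfin
  exact fourEight_ne_two_zsmul_add_cm7_quadraticTwist_neg_two_rat 0 _ hfin (by rw [zsmul_zero, zero_add])

/-- **`rank cm7^{(−2)}(ℚ) ≤ 1`, and `= 1 ⇒ Ш(cm7^{(−2)}/ℚ)[2] = 0`** — seat c301 gen 2's descent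
(`rank_le_one_and_sha_two_inertTwoTwist`, `S(−42,448) ⊆ {1,2,7,14}`, `S(84,−28) ⊆ {1,−7}`) at
`m = 1`. [cite: SilvermanAEC2009, Thm. X.4.2(a), Prop. X.4.9] -/
theorem rank_le_one_and_sha_two_cm7_quadraticTwist_neg_two :
    (cm7.quadraticTwist (-2)).mordellWeilRank ≤ 1 ∧
      ((cm7.quadraticTwist (-2)).mordellWeilRank = 1 →
        ∀ c ∈ (cm7.quadraticTwist (-2)).sha, 2 • c = 0 → c = 0) := by
  haveI := isElliptic_cm7_quadraticTwist_neg_two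
  refine rank_le_one_and_sha_two_inertTwoTwist (m := 1) one_pos squarefree_one
    (fun l hl h1 => absurd (Nat.dvd_one.mp h1) hl.ne_one) (cm7.quadraticTwist (-2)) 1 ?_
  rw [one_smul]; norm_num

/-- **`rank cm7^{(−2)}(ℚ) = 1`** (UNCONDITIONAL). This is the curve `[0,0,0,−140,784]` of conductor
`3136` (`49a1^{(−2)}`), the FIXED rank-one partner of the genus mechanism on the family
`49a1^{(−2q)}`, `q ≡ 1 (mod 4)`. [cite: SilvermanAEC2009, Thm. X.4.2(a) and Thm. VIII.6.7] -/
theorem mordellWeilRank_cm7_quadraticTwist_neg_two : (cm7.quadraticTwist (-2)).mordellWeilRank = 1 := by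
  haveI := isElliptic_cm7_quadraticTwist_neg_two
  refine le_antisymm rank_le_one_and_sha_two_cm7_quadraticTwist_neg_two.1 ?_
  refine one_le_mordellWeilRank_of_not_isOfFinAddOrder_rat (cm7.quadraticTwist (-2))
    (P := Affine.Point.some 4 8 nonsingular_cm7_quadraticTwist_neg_two_four_eight) ?_
  convert not_isOfFinAddOrder_fourEight_cm7_quadraticTwist_neg_two_rat

/-- **`Ш(cm7^{(−2)}/ℚ)[2] = 0`** (UNCONDITIONAL). [cite: SilvermanAEC2009, Thm. X.4.2(a), Prop. X.4.9] -/
theorem forall_mem_sha_two_cm7_quadraticTwist_neg_two :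
    ∀ c ∈ (cm7.quadraticTwist (-2)).sha, 2 • c = 0 → c = 0 :=
  rank_le_one_and_sha_two_cm7_quadraticTwist_neg_two.2 mordellWeilRank_cm7_quadraticTwist_neg_two

/-- **Odd index of `(4, 8)`**: every `P ∈ cm7^{(−2)}(ℚ)` satisfies `n • P − a • (4,8) ∈ tors` for some
ODD `n` and some `a`. [cite: SilvermanAEC2009, Thm. VIII.6.7] [cite: SilvermanTate2015, §3.5] -/
theorem exists_odd_zsmul_sub_zsmul_fourEight_cm7_quadraticTwist_neg_two
    (P : (cm7.quadraticTwist (-2)).toAffine.Point) :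
    ∃ n a : ℤ, Odd n ∧ IsOfFinAddOrder
      (n • P - a • Affine.Point.some 4 8 nonsingular_cm7_quadraticTwist_neg_two_four_eight) := by
  haveI := isElliptic_cm7_quadraticTwist_neg_two
  haveI : Module.Finite ℤ (cm7.quadraticTwist (-2)).toAffine.Point := by
    convert (cm7.quadraticTwist (-2)).module_finite_point_holds
  have h1 : Module.finrank ℤ (cm7.quadraticTwist (-2)).toAffine.Point = 1 := by
    have h := mordellWeilRank_cm7_quadraticTwist_neg_two
    unfold WeierstrassCurve.mordellWeilRank at h
    convert h
  exact exists_odd_zsmul_sub_zsmul_isOfFinAddOrder h1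
    not_isOfFinAddOrder_fourEight_cm7_quadraticTwist_neg_two_rat
    fourEight_ne_two_zsmul_add_cm7_quadraticTwist_neg_two_rat P

/-- **Along any Mordell–Weil basis `P₀` of `cm7^{(−2)}(ℚ)` (rank one), `(4,8) ≡ k • P₀ (mod tors)`
with `k` ODD.** [cite: SilvermanAEC2009, Ch. VIII intro (p. 207)] [cite: SilvermanTate2015, §3.5] -/
theorem exists_odd_fourEight_sub_zsmul_basis_cm7_quadraticTwist_neg_two
    {P : Fin 1 → (cm7.quadraticTwist (-2)).toAffine.Point} (hP : IsMordellWeilBasis P) :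
    ∃ k : ℤ, Odd k ∧ IsOfFinAddOrder
      (Affine.Point.some 4 8 nonsingular_cm7_quadraticTwist_neg_two_four_eight - k • P 0) := by
  obtain ⟨a, ha⟩ := exists_sub_zsmul_isOfFinAddOrder_of_isMordellWeilBasis hP
    (Affine.Point.some 4 8 nonsingular_cm7_quadraticTwist_neg_two_four_eight)
  have ha' : IsOfFinAddOrder
      (Affine.Point.some 4 8 nonsingular_cm7_quadraticTwist_neg_two_four_eight - a • P 0) := by
    convert ha
  exact ⟨a, odd_of_sub_zsmul_isOfFinAddOrder fourEight_ne_two_zsmul_add_cm7_quadraticTwist_neg_two_rat ha',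
    ha'⟩

end NegTwo

end Summit.BirchSwinnertonDyer.BirchSwinnertonDyer.Theorems.GoldfeldGoodTwists

end
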